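import Literature.Topology.FourManifolds.ConnectedSumNormalForm
import Literature.Topology.FourManifolds.DiscTheoremDiffeotopy
import Literature.Topology.FourManifolds.GaussDiagrams
import HarnessLib

/-!
# The track of an isotopy between knots off the north pole can be pushed off the north pole

Topic `Literature/Topology/FourManifolds`; a brick for the Reidemeister-type arguments on knot
diagrams (`GaussDiagrams.lean`: diagrams are drawn by stereographic projection from
`Literature.Topology.FourManifolds.northPole`, so only knots missing the north pole have plane
curves, and an isotopy between two such knots can be followed through the chart only as long as
the moving knot stays off the pole).  Everything here is proved; no named facts are introduced.

* `Literature.Topology.FourManifolds.Knot.exists_forall_ne_of_ambientIsotopy_of_mem_nhds_northPole`,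
  `Literature.Topology.FourManifolds.Knot.exists_forall_ne_of_ambientIsotopy_of_mem_nhds`,
  `Literature.Topology.FourManifolds.Knot.dense_setOf_forall_ambientIsotopy_ne` — **general
  position**: for an ambient isotopy `F` of `𝕊 3` and a knot `A`, every neighbourhood of every
  point of `𝕊 3` contains a point `y` never met by the moving knot, `F t (A x) ≠ y` for all real
  times `t` and all `x` (the complement of the full track is dense; the track, a smooth image of
  a surface, is null — Sard (1942) in its trivial case, Hirsch (1976), Ch. 3 §1, Prop. 1.2);
* `Literature.Topology.FourManifolds.Knot.IsIsotopic.exists_ambientIsotopy_forall_ne` — if two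
  knots `K ≅ K'` both miss a point `q`, then some ambient isotopy `F` from `K` to `K'`
  (`F 1 ∘ K = K'`) has its whole track off `q`: `F t (K x) ≠ q` for all `t` and `x`;
* `Literature.Topology.FourManifolds.Knot.IsIsotopic.exists_ambientIsotopy_forall_ne_northPole` —
  the case `q = northPole`, with the track condition on `0 ≤ t ≤ 1`, in the form consumed by the
  diagrammatic files.

## Proof sketch

Let `F` be an ambient isotopy with `F 1 ∘ K = K'`, and `q ∉ K(𝕊¹) ∪ K'(𝕊¹)`.
1. *A small connected neighbourhood.* `𝕊 3` is locally connected (it is a manifold), so `q` has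
   a connected open neighbourhood `W` disjoint from the compact set `K(𝕊¹) ∪ K'(𝕊¹)`.
2. *General position.* The track `(t, θ) ↦ F t (K (cos θ, sin θ))` is a smooth map of the
   plane, hence its image has empty interior (`KnotsInBall.lean`,
   `Knot.exists_forall_ne_of_ambientIsotopy`: every polar cap around the south pole contains a
   point off the track, by Mathlib's `addHaar_image_eq_zero_of_differentiableOn_of_addHaar_eq_zero`);
   conjugating by the half-turn of `𝕊 3` (`halfTurn`, exchanging the poles) and then by a
   diffeomorphism moving `q` to the north pole (homogeneity, `Homogeneity.lean`) gives a point
   `y ∈ W` off the track.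
3. *Point pushing with support.* By homogeneity inside the connected open set `W`
   (`Diffeomorph.exists_isCompactlyDiffeotopicToIdIn_apply_eq`, `DiscTheoremDiffeotopy.lean`;
   Hirsch (1976), Ch. 8 §3, Thm. 3.1 with `k = 0` and Ch. 8 §1, Thms. 1.3–1.4 for the support;
   Milnor (1965), §4, Homogeneity Lemma) there is a diffeomorphism `P` of `𝕊 3` with `P y = q`
   which is the identity off `W`, in particular on `K(𝕊¹) ∪ K'(𝕊¹)`.
4. *Conjugation.* The ambient isotopy `P ∘ F t ∘ P⁻¹` (`AmbientIsotopy.conj`) still starts at the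
   identity, ends with `P ∘ F 1 ∘ P⁻¹ ∘ K = P ∘ F 1 ∘ K = P ∘ K' = K'`, and its track
   `P (F t (K x))` meets `q = P y` only if `F t (K x) = y`, which never happens.

## References

* M. W. Hirsch, *Differential Topology*, GTM 33 (1976), Ch. 3 §1, Prop. 1.2 (images of
  lower-dimensional manifolds are nowhere dense); Ch. 8 §1, Thms. 1.3–1.4 (isotopy extension
  with compact support) and Exercise 14; Ch. 8 §3, Thm. 3.1 (homogeneity by diffeotopies).
  [HirschDT1976]
* J. Milnor, *Topology from the differentiable viewpoint* (1965), §4, Homogeneity Lemma.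
  [MilnorTDV1965]
* A. Sard, *The measure of the critical values of differentiable maps*, Bull. AMS 48 (1942).
  [Sard1942]

## Design notes

* The general-position statement is proved for **all real times** `t` (the library's ambient
  isotopies are families over `ℝ`), which is stronger than the statement on `[0, 1]` recorded in
  the final corollary.
* `northPole` is `Literature.Topology.FourManifolds.northPole` of `GaussDiagrams.lean`; the
  point `KnotsInBall.northPole` of `KnotsInBall.lean` is definitionally the same point
  (`KnotsInBall.northPole_eq_northPole`), so both APIs apply.
* No new definitions; `𝔼 n`, `𝕊 n` are local notation as in `Knots.lean`.
-/

open scoped Manifold ContDiff Topology RealInnerProductSpace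
open Function Set Metric

noncomputable section

namespace Literature.Topology.FourManifolds

/-- Local notation: `𝔼 n` is the model Euclidean space `EuclideanSpace ℝ (Fin n)`. -/
local notation "𝔼 " n:arg => EuclideanSpace ℝ (Fin n)

/-- Local notation: `𝕊 n` is the unit sphere in `EuclideanSpace ℝ (Fin (n + 1))`. -/
local notation "𝕊 " n:arg => (Metric.sphere (0 : EuclideanSpace ℝ (Fin (n + 1))) 1)

attribute [local instance] fact_finrank_euclideanSpace_succ

/-! ### The two north poles of the tree agree -/

/-- The north pole `KnotsInBall.northPole` of `KnotsInBall.lean` (last coordinate `Fin.last 3`)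
is the north pole `northPole` of `GaussDiagrams.lean` (coordinate `3`). [folklore] -/
theorem KnotsInBall.northPole_eq_northPole : KnotsInBall.northPole = northPole := rfl

/-- **Distance to the north pole in terms of the last coordinate**: on the unit sphere,
`‖y - N‖² = 2 - 2 y₃`. [folklore] -/
theorem norm_sub_northPole_sq (y : 𝕊 3) :
    ‖(y : 𝔼 4) - ((northPole : 𝕊 3) : 𝔼 4)‖ ^ 2 = 2 - 2 * (y : 𝔼 4) (Fin.last 3) := by
  rw [norm_sub_sq_real, norm_eq_of_mem_sphere y, norm_eq_of_mem_sphere (northPole : 𝕊 3),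
    real_inner_comm]
  rw [show ⟪((northPole : 𝕊 3) : 𝔼 4), (y : 𝔼 4)⟫ = (y : 𝔼 4) (Fin.last 3) from KnotsInBall.inner_northPole y]
  ring

/-- The round `3`-sphere is connected (private copy of the tree's
`connectedSpace_sphere_three`, `CerfIsotopySphereThree.lean`, and `Knot.connectedSpace_sphereThree`,
`KnotFlatArc.lean`, neither of which is imported here). [folklore] -/
private theorem connectedSpace_sphereThree_aux : ConnectedSpace (𝕊 3) := by
  refine isConnected_iff_connectedSpace.mp (isConnected_sphere ?_ 0 zero_le_one)
  rw [← Module.finrank_eq_rank, finrank_euclideanSpace_fin]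
  norm_num

/-! ### General position: the complement of the track of a moving knot is dense -/

namespace Knot

/-- **General position near the north pole.** For an ambient isotopy `F` of `𝕊 3` and a knot
`A`, every neighbourhood `U` of the north pole contains a point `y` never met by the moving knot:
`F t (A x) ≠ y` for all real `t` and all `x`.  Proof: conjugate by the half-turn `rot_π`
(exchanging the poles) and apply the southern general-position theorem
`Knot.exists_forall_ne_of_ambientIsotopy` of `KnotsInBall.lean` to the cap
`{x₃ < -1 + ε²/2}`, whose image under `rot_π` lies in the ball of radius `ε` about the north
pole (`‖y - N‖² = 2 - 2 y₃`). Hirsch (1976), Ch. 3 §1, Prop. 1.2; Ch. 8 §1, Exercise 14.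
[cite: HirschDT1976, Ch. 3 §1 Prop. 1.2] -/
theorem exists_forall_ne_of_ambientIsotopy_of_mem_nhds_northPole (F : AmbientIsotopy (𝓡 3) (𝕊 3))
    (A : Knot) {U : Set (𝕊 3)} (hU : U ∈ 𝓝 (northPole : 𝕊 3)) :
    ∃ y ∈ U, ∀ t x, F.toFun t (A x) ≠ y := by
  obtain ⟨ε, hε, hball⟩ := Metric.mem_nhds_iff.1 hU
  have hc : (-1 : ℝ) < -1 + ε ^ 2 / 2 := by
    have : 0 < ε ^ 2 / 2 := by positivity
    linarith
  obtain ⟨p, hp, hpF⟩ :=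
    Knot.exists_forall_ne_of_ambientIsotopy (F.conj halfTurn) (A.map halfTurn) hc
  -- the last coordinate of `rot_π⁻¹ p` is `-p₃`
  have h3 : ((halfTurn.symm p : 𝕊 3) : 𝔼 4) (Fin.last 3) = -(p : 𝔼 4) (Fin.last 3) := by
    have h := halfTurn_apply_last (halfTurn.symm p)
    rw [halfTurn.apply_symm_apply] at h
    linarith
  refine ⟨halfTurn.symm p, hball ?_, fun t x hx ↦ hpF t x ?_⟩
  · -- `rot_π⁻¹ p` is `ε`-close to the north pole
    rw [Metric.mem_ball, Subtype.dist_eq, dist_eq_norm]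
    have hsq : ‖((halfTurn.symm p : 𝕊 3) : 𝔼 4) - ((northPole : 𝕊 3) : 𝔼 4)‖ ^ 2 < ε ^ 2 := by
      rw [norm_sub_northPole_sq, h3]
      linarith
    exact lt_of_pow_lt_pow_left₀ 2 hε.le hsq
  · -- a hit at `rot_π⁻¹ p` is a hit of the conjugated track at `p`
    rw [AmbientIsotopy.conj_toFun, SphereEmbedding.map_apply, comp_apply, comp_apply,
      halfTurn.symm_apply_apply, hx, halfTurn.apply_symm_apply]

/-- **General position near any point.** For an ambient isotopy `F` of `𝕊 3`, a knot `A` and a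
point `q`, every neighbourhood `U` of `q` contains a point `y` never met by the moving knot
(`F t (A x) ≠ y` for all real `t` and all `x`): conjugate by a diffeomorphism of the connected
manifold `𝕊 3` taking `q` to the north pole (homogeneity,
`Diffeomorph.exists_isDiffeotopicToId_apply_eq_of_connectedSpace`) and use the polar case.
Hirsch (1976), Ch. 3 §1, Prop. 1.2 (the image of a smooth map from a lower-dimensional manifold
is nowhere dense). [cite: HirschDT1976, Ch. 3 §1 Prop. 1.2] -/
theorem exists_forall_ne_of_ambientIsotopy_of_mem_nhds (F : AmbientIsotopy (𝓡 3) (𝕊 3))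
    (A : Knot) {q : 𝕊 3} {U : Set (𝕊 3)} (hU : U ∈ 𝓝 q) :
    ∃ y ∈ U, ∀ t x, F.toFun t (A x) ≠ y := by
  haveI := connectedSpace_sphereThree_aux
  obtain ⟨P, -, hPq⟩ := Diffeomorph.exists_isDiffeotopicToId_apply_eq_of_connectedSpace
    (E := 𝔼 3) (M := 𝕊 3) q northPole
  -- `P⁻¹` pulls `U` back to a neighbourhood of the north pole
  have hU' : P.symm ⁻¹' U ∈ 𝓝 (northPole : 𝕊 3) := by
    refine P.symm.continuous.continuousAt.preimage_mem_nhds ?_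
    rwa [← hPq, P.symm_apply_apply]
  obtain ⟨y, hyU, hy⟩ :=
    exists_forall_ne_of_ambientIsotopy_of_mem_nhds_northPole (F.conj P) (A.map P) hU'
  refine ⟨P.symm y, hyU, fun t x hx ↦ hy t x ?_⟩
  rw [AmbientIsotopy.conj_toFun, SphereEmbedding.map_apply, comp_apply, comp_apply,
    P.symm_apply_apply, hx, P.apply_symm_apply]

/-- **The complement of the track of a moving knot is dense in `𝕊 3`** (the track
`{F t (A x)}`, a smooth image of the surface `ℝ × 𝕊¹`, has empty interior). Hirsch (1976),
Ch. 3 §1, Prop. 1.2; Sard (1942). [cite: HirschDT1976, Ch. 3 §1 Prop. 1.2] -/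
theorem dense_setOf_forall_ambientIsotopy_ne (F : AmbientIsotopy (𝓡 3) (𝕊 3)) (A : Knot) :
    Dense {y : 𝕊 3 | ∀ t x, F.toFun t (A x) ≠ y} := by
  refine dense_iff_inter_open.2 fun U hUo ⟨q, hqU⟩ ↦ ?_
  obtain ⟨y, hyU, hy⟩ := exists_forall_ne_of_ambientIsotopy_of_mem_nhds F A (hUo.mem_nhds hqU)
  exact ⟨y, hyU, hy⟩

/-! ### Pushing the track of an isotopy off a point -/

/-- **An isotopy between two knots missing a point `q` can be chosen with its track off `q`.**
If `K ≅ K'` are ambient isotopic knots in `𝕊 3` and both miss `q`, then there is an ambient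
isotopy `F` of `𝕊 3` with `F 1 ∘ K = K'` and `F t (K x) ≠ q` for all real `t` and all `x`.
Proof: take any ambient isotopy `F₀` from `K` to `K'`; choose a connected open neighbourhood `W`
of `q` off the compact set `K(𝕊¹) ∪ K'(𝕊¹)` (manifolds are locally connected), a point `y ∈ W`
off the track of `F₀` (general position, `exists_forall_ne_of_ambientIsotopy_of_mem_nhds`), and
a diffeomorphism `P` of `𝕊 3` with `P y = q` which is the identity off `W`
(`Diffeomorph.exists_isCompactlyDiffeotopicToIdIn_apply_eq`: homogeneity by a compactly
supported diffeotopy inside `W`); then the conjugate `P ∘ F₀ t ∘ P⁻¹` (`AmbientIsotopy.conj`)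
is the required isotopy, since `P` fixes `K` and `K'` pointwise and `P (F₀ t (K x)) = q = P y`
would force `F₀ t (K x) = y`. Hirsch (1976), Ch. 8 §1, Exercise 14 and Thms. 1.3–1.4; Ch. 8
§3, Thm. 3.1 (`k = 0`); Milnor (1965), §4, Homogeneity Lemma.
[cite: HirschDT1976, Ch. 8 §1 Exercise 14 and Ch. 8 §3 Thm. 3.1] -/
theorem IsIsotopic.exists_ambientIsotopy_forall_ne {K K' : Knot} (h : K.IsIsotopic K')
    {q : 𝕊 3} (hK : ∀ x, K x ≠ q) (hK' : ∀ x, K' x ≠ q) :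
    ∃ F : AmbientIsotopy (𝓡 3) (𝕊 3), F.toFun 1 ∘ ⇑K = ⇑K' ∧ ∀ t x, F.toFun t (K x) ≠ q := by
  obtain ⟨F, hF⟩ := h
  -- (1) a connected open neighbourhood `W` of `q` missing `K` and `K'`
  have hU : (range K ∪ range K')ᶜ ∈ 𝓝 q := by
    refine (K.isClosed_range.union K'.isClosed_range).isOpen_compl.mem_nhds ?_
    rintro (⟨x, hx⟩ | ⟨x, hx⟩)
    exacts [hK x hx, hK' x hx]
  haveI := ChartedSpace.locallyConnectedSpace (𝔼 3) (𝕊 3)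
  obtain ⟨W, ⟨hWo, hqW, hWc⟩, hWU⟩ :=
    (LocallyConnectedSpace.open_connected_basis q).mem_iff.1 hU
  -- (2) general position: a point of `W` off the whole track
  obtain ⟨y, hyW, hy⟩ := exists_forall_ne_of_ambientIsotopy_of_mem_nhds F K (hWo.mem_nhds hqW)
  -- (3) push `y` to `q` by a diffeomorphism supported in `W`
  obtain ⟨P, ⟨D, C, -, hCW, hD1, hDC⟩, hPy⟩ :=
    Diffeomorph.exists_isCompactlyDiffeotopicToIdIn_apply_eq (n := 3) hWo hWc.isPreconnected
      hyW hqW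
  have hPfix : ∀ z ∉ W, P z = z := fun z hz ↦ by
    rw [← hD1, Diffeotopy.coe_stage]
    exact hDC 1 z fun hzC ↦ hz (hCW hzC)
  have hPK : ∀ x, P (K x) = K x := fun x ↦ hPfix _ fun hxW ↦ hWU hxW (Or.inl ⟨x, rfl⟩)
  have hPK' : ∀ x, P (K' x) = K' x := fun x ↦ hPfix _ fun hxW ↦ hWU hxW (Or.inr ⟨x, rfl⟩)
  have hPsK : ∀ x, P.symm (K x) = K x := fun x ↦ by
    conv_lhs => rw [← hPK x]
    exact P.symm_apply_apply (K x)
  -- (4) conjugate the isotopy by `P`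
  refine ⟨F.conj P, ?_, fun t x hx ↦ hy t x ?_⟩
  · funext x
    rw [comp_apply, AmbientIsotopy.conj_toFun, comp_apply, comp_apply, hPsK,
      show F.toFun 1 (K x) = K' x from congrFun hF x, hPK']
  · rw [AmbientIsotopy.conj_toFun, comp_apply, comp_apply, hPsK, ← hPy] at hx
    exact P.injective hx

/-- **The track of an isotopy between two knots missing the north pole can be pushed off the
north pole**: if `K ≅ K'` are ambient isotopic knots in `𝕊 3`, both missing the north pole,
then some ambient isotopy `F` with `F 1 ∘ K = K'` moves `K` without ever passing through the
north pole during `0 ≤ t ≤ 1` (indeed at any real time, `exists_ambientIsotopy_forall_ne`), so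
that the whole isotopy can be drawn in the stereographic chart from the north pole
(`GaussDiagrams.lean`). Hirsch (1976), Ch. 8 §1, Exercise 14; Ch. 8 §3, Thm. 3.1; Milnor
(1965), §4. [cite: HirschDT1976, Ch. 8 §1 Exercise 14 and Ch. 8 §3 Thm. 3.1] -/
theorem IsIsotopic.exists_ambientIsotopy_forall_ne_northPole {K K' : Knot}
    (h : K.IsIsotopic K') (hK : ∀ x, K x ≠ northPole) (hK' : ∀ x, K' x ≠ northPole) :
    ∃ F : AmbientIsotopy (𝓡 3) (𝕊 3), F.toFun 1 ∘ ⇑K = ⇑K' ∧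
      ∀ t ∈ Set.Icc (0 : ℝ) 1, ∀ x, F.toFun t (K x) ≠ northPole := by
  obtain ⟨F, hF, hne⟩ := IsIsotopic.exists_ambientIsotopy_forall_ne h hK hK'
  exact ⟨F, hF, fun t _ x ↦ hne t x⟩

end Knot

end Literature.Topology.FourManifolds
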